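import Mathlib.Analysis.SpecialFunctions.Integrals.Basic
import HarnessLib

/-!
# RiemannHypothesis / DBN — RH-FREE bookkeeping of the zero dynamics: T7, T8, T9 (support-grade)

Column DBN of the RH ladder (D-0040 record-keeping; `pub-dbn` theory memo THEORY-R3 §3/§6,
`Sketch3.lean` sha16 4221bacfb0657169, namespace `DbnTheory3`).  The Csordas–Smith–Varga /
Rodgers–Tao velocity field of the heat-flow zero dynamics `ż_k = 2 Σ_{j ≠ k} (z_k − z_j)⁻¹` at ONE
instant — pure `Finset` algebra over a finite configuration `z : Fin n → ℂ`, no ODE theory, no `H_t`,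
nothing about ζ — and three typed RH-FREE statements, byte-verbatim from the sketch, each PROVED here
(sorry-free, standard axioms):

* `velocity`                    — the velocity field;
* `SumSqHeightsLyapunov` (T7)   — `Σ_k y_k · Im ż_k = − Σ_k Σ_{j≠k} (y_k−y_j)²/|z_k−z_j|²`
                                  (so `Σ y_k²` is non-increasing: finite form of de Bruijn's monotonicity);
* `UpperHeightSumDescent` (T8)  — for conjugation-closed configurations
                                  `Σ_{y_k>0} Im ż_k ≤ − Σ_{y_k>0} 1/y_k` (upper–upper terms cancel by
                                  antisymmetry, lower zeros push down, the own conjugate gives `−1/y_k`);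
* `RoofDeficitProfile` (T9)     — the windowed Poisson masses `∫_{−D}^{D} 4Y/(u²+4Y²) = 4·arctan(D/2Y)`,
                                  `∫_{−D}^{D} 2·2Y/(u²+Y²) = 8·arctan(D/Y)` behind the roof profile of R3 §3.

The injectivity hypotheses of T7/T8 are part of the typed statements but are not needed by the proofs
(coincident points contribute `0/0 = 0`).  `--supports stmt-RiemannHypothesis-0274`; nothing here
bears on the truth of RH.
-/

noncomputable section

-- D-0017: `Summit.<S>.<S>.…` is the designed namespace of a single-problem summit.
set_option linter.dupNamespace false

open scoped Real
open Complex Finset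

namespace Summit.RiemannHypothesis.RiemannHypothesis.Theorems.DbnTheory

/-- Velocity of the `k`-th zero in the Csordas–Smith–Varga / Rodgers–Tao dynamics
`ż_k = 2 Σ_{j ≠ k} (z_k − z_j)⁻¹`, at one instant (verbatim `DbnTheory3.velocity`). [folklore] -/
def velocity {n : ℕ} (z : Fin n → ℂ) (k : Fin n) : ℂ :=
  2 * ∑ j ∈ univ.erase k, 1 / (z k - z j)

/-- TARGET T7 (RH-FREE, support-grade) — the `Σ y²` Lyapunov identity of the zero dynamics (finite
system).  Verbatim `DbnTheory3.SumSqHeightsLyapunov`. -/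
def SumSqHeightsLyapunov : Prop :=
  ∀ (n : ℕ) (z : Fin n → ℂ), Function.Injective z →
    ∑ k, (z k).im * (velocity z k).im
      = - ∑ k, ∑ j ∈ univ.erase k, ((z k).im - (z j).im) ^ 2 / Complex.normSq (z k - z j)

/-- TARGET T8 (RH-FREE, support-grade) — descent of the total upper height for conjugation-closed
configurations: `Σ_{y_k>0} ẏ_k ≤ −Σ_{y_k>0} 1/y_k`.  Verbatim `DbnTheory3.UpperHeightSumDescent`. -/
def UpperHeightSumDescent : Prop :=
  ∀ (n : ℕ) (z : Fin n → ℂ), Function.Injective z →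
    (∀ k, ∃ j, z j = (starRingEnd ℂ) (z k)) →
      ∑ k ∈ univ.filter (fun k => 0 < (z k).im), (velocity z k).im
        ≤ - ∑ k ∈ univ.filter (fun k => 0 < (z k).im), 1 / (z k).im

/-- TARGET T9 (RH-FREE, calculus) — windowed masses of the roof kernel `4Y/(u²+4Y²)` and of two
real zeros `2·2Y/(u²+Y²)`.  Verbatim `DbnTheory3.RoofDeficitProfile`. -/
def RoofDeficitProfile : Prop :=
  ∀ Y D : ℝ, 0 < Y → 0 < D →
    (∫ u in (-D)..D, 4 * Y / (u ^ 2 + (2 * Y) ^ 2) = 4 * Real.arctan (D / (2 * Y))) ∧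
    (∫ u in (-D)..D, 2 * (2 * Y / (u ^ 2 + Y ^ 2)) = 8 * Real.arctan (D / Y))

/-! ## T9 -/

/-- `∫_{−D}^{D} a/(u²+a²) du = 2·arctan(D/a)` for `a > 0` (substitute `u = a x`). [folklore] -/
theorem integral_poisson_symm {a : ℝ} (ha : 0 < a) (D : ℝ) :
    ∫ u in (-D)..D, a / (u ^ 2 + a ^ 2) = 2 * Real.arctan (D / a) := by
  have ha0 : a ≠ 0 := ha.ne'
  have h : (fun u : ℝ => a / (u ^ 2 + a ^ 2)) = fun u => a⁻¹ * (1 + (u / a) ^ 2)⁻¹ := by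
    funext u
    field_simp
    ring
  rw [h, intervalIntegral.integral_const_mul,
    intervalIntegral.integral_comp_div (fun x : ℝ => (1 + x ^ 2)⁻¹) ha0, smul_eq_mul,
    integral_inv_one_add_sq, neg_div, Real.arctan_neg]
  field_simp
  ring

/-- **`RoofDeficitProfile`** (T9). [folklore] -/
theorem RoofDeficitProfile_holds : RoofDeficitProfile := by
  intro Y D hY _
  have h2Y : 0 < 2 * Y := by linarith
  constructor
  · have h : (fun u : ℝ => 4 * Y / (u ^ 2 + (2 * Y) ^ 2)) = fun u => 2 * (2 * Y / (u ^ 2 + (2 * Y) ^ 2)) := by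
      funext u; ring
    rw [h, intervalIntegral.integral_const_mul, integral_poisson_symm h2Y]
    ring
  · rw [intervalIntegral.integral_const_mul]
    have h : (fun u : ℝ => 2 * Y / (u ^ 2 + Y ^ 2)) = fun u => 2 * (Y / (u ^ 2 + Y ^ 2)) := by
      funext u; ring
    rw [h, intervalIntegral.integral_const_mul, integral_poisson_symm hY]
    ring

/-! ## T7, T8 -/

/-- `normSq (a − b) = normSq (b − a)`. [folklore] -/
theorem normSq_sub_comm (a b : ℂ) : Complex.normSq (a - b) = Complex.normSq (b - a) := by
  rw [← Complex.normSq_neg, neg_sub]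

/-- Imaginary part of the velocity as a full sum (the diagonal term is `0/0 = 0`):
`Im ż_k = −2 Σ_j (y_k − y_j)/|z_k − z_j|²`. [folklore] -/
theorem velocity_im {n : ℕ} (z : Fin n → ℂ) (k : Fin n) :
    (velocity z k).im = -2 * ∑ j, ((z k).im - (z j).im) / Complex.normSq (z k - z j) := by
  unfold velocity
  rw [Finset.sum_erase_eq_sub (Finset.mem_univ k)]
  simp only [sub_self, div_zero, sub_zero, Complex.mul_im, Complex.im_sum, Complex.re_sum, one_div,
    Complex.inv_im, Complex.sub_im, Complex.re_ofNat, Complex.im_ofNat, zero_mul, add_zero]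
  rw [Finset.mul_sum, Finset.mul_sum]
  refine Finset.sum_congr rfl fun j _ => ?_
  ring

/-- **`SumSqHeightsLyapunov`** (T7): symmetrise the ordered double sum. [folklore] -/
theorem SumSqHeightsLyapunov_holds : SumSqHeightsLyapunov := by
  intro n z _
  -- erase-sums are full sums: the diagonal terms vanish
  have hfull : ∀ k : Fin n, ∑ j ∈ univ.erase k, ((z k).im - (z j).im) ^ 2 / Complex.normSq (z k - z j)
      = ∑ j, ((z k).im - (z j).im) ^ 2 / Complex.normSq (z k - z j) := by
    intro k
    rw [Finset.sum_erase_eq_sub (Finset.mem_univ k)]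
    simp
  simp_rw [hfull, velocity_im]
  -- symmetrisation
  have hsym : ∑ k, ∑ j, ((z k).im - (z j).im) ^ 2 / Complex.normSq (z k - z j)
      = ∑ k, ∑ j, (z k).im * ((z k).im - (z j).im) / Complex.normSq (z k - z j)
        + ∑ k, ∑ j, (z j).im * ((z j).im - (z k).im) / Complex.normSq (z j - z k) := by
    rw [← Finset.sum_add_distrib]
    refine Finset.sum_congr rfl fun k _ => ?_
    rw [← Finset.sum_add_distrib]
    refine Finset.sum_congr rfl fun j _ => ?_
    rw [normSq_sub_comm (z j) (z k)]
    ring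
  have hswap : ∑ k, ∑ j, (z j).im * ((z j).im - (z k).im) / Complex.normSq (z j - z k)
      = ∑ k, ∑ j, (z k).im * ((z k).im - (z j).im) / Complex.normSq (z k - z j) := by
    rw [Finset.sum_comm]
  rw [hsym, hswap]
  have hlhs : ∑ k, (z k).im * (-2 * ∑ j, ((z k).im - (z j).im) / Complex.normSq (z k - z j))
      = -2 * ∑ k, ∑ j, (z k).im * ((z k).im - (z j).im) / Complex.normSq (z k - z j) := by
    simp only [Finset.mul_sum]
    refine Finset.sum_congr rfl fun k _ => Finset.sum_congr rfl fun j _ => ?_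
    ring
  rw [hlhs]
  ring

/-- **`UpperHeightSumDescent`** (T8): upper–upper interactions cancel by antisymmetry, every zero with
`y_j ≤ 0` contributes `≤ 0` to an upper zero's velocity, and the conjugate partner contributes exactly
`−1/y_k`. [folklore] -/
theorem UpperHeightSumDescent_holds : UpperHeightSumDescent := by
  intro n z _ hconj
  -- terms t k j := (y_k − y_j)/|z_k − z_j|²
  have hanti : ∑ k ∈ univ.filter (fun k => 0 < (z k).im), ∑ j ∈ univ.filter (fun k => 0 < (z k).im),
      ((z k).im - (z j).im) / Complex.normSq (z k - z j) = 0 := by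
    have hs : ∑ k ∈ univ.filter (fun k => 0 < (z k).im), ∑ j ∈ univ.filter (fun k => 0 < (z k).im),
        ((z k).im - (z j).im) / Complex.normSq (z k - z j)
        = - ∑ k ∈ univ.filter (fun k => 0 < (z k).im), ∑ j ∈ univ.filter (fun k => 0 < (z k).im),
          ((z k).im - (z j).im) / Complex.normSq (z k - z j) := by
      conv_lhs => rw [Finset.sum_comm]
      rw [← Finset.sum_neg_distrib]
      refine Finset.sum_congr rfl fun k _ => ?_
      rw [← Finset.sum_neg_distrib]
      refine Finset.sum_congr rfl fun j _ => ?_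
      rw [normSq_sub_comm (z j) (z k)]
      ring
    linarith
  have hlow : ∀ k ∈ univ.filter (fun k => 0 < (z k).im),
      1 / (2 * (z k).im) ≤ ∑ j ∈ univ.filter (fun j => ¬ 0 < (z j).im),
        ((z k).im - (z j).im) / Complex.normSq (z k - z j) := by
    intro k hk
    have hyk : 0 < (z k).im := (Finset.mem_filter.mp hk).2
    obtain ⟨j, hj⟩ := hconj k
    have hyj : (z j).im = -(z k).im := by rw [hj, Complex.conj_im]
    have hxj : (z j).re = (z k).re := by rw [hj, Complex.conj_re]
    have hjmem : j ∈ univ.filter (fun j => ¬ 0 < (z j).im) := by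
      rw [Finset.mem_filter]; exact ⟨Finset.mem_univ j, by rw [hyj]; linarith⟩
    have hterm : ((z k).im - (z j).im) / Complex.normSq (z k - z j) = 1 / (2 * (z k).im) := by
      rw [Complex.normSq_apply, Complex.sub_re, Complex.sub_im, hyj, hxj]
      have hyk0 : (z k).im ≠ 0 := hyk.ne'
      field_simp
      ring
    rw [← hterm]
    refine Finset.single_le_sum (f := fun j => ((z k).im - (z j).im) / Complex.normSq (z k - z j))
      (fun j' hj' => ?_) hjmem
    have hyj' : (z j').im ≤ 0 := not_lt.mp (Finset.mem_filter.mp hj').2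
    exact div_nonneg (by linarith) (Complex.normSq_nonneg _)
  -- assemble
  have hsum : ∑ k ∈ univ.filter (fun k => 0 < (z k).im), (velocity z k).im
      = -2 * ∑ k ∈ univ.filter (fun k => 0 < (z k).im), ∑ j ∈ univ.filter (fun j => ¬ 0 < (z j).im),
          ((z k).im - (z j).im) / Complex.normSq (z k - z j) := by
    have h1 : ∀ k, (velocity z k).im = -2 * (∑ j ∈ univ.filter (fun k => 0 < (z k).im),
        ((z k).im - (z j).im) / Complex.normSq (z k - z j)
        + ∑ j ∈ univ.filter (fun j => ¬ 0 < (z j).im), ((z k).im - (z j).im) / Complex.normSq (z k - z j)) := by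
      intro k
      rw [velocity_im, Finset.sum_filter_add_sum_filter_not]
    simp_rw [h1]
    rw [← Finset.mul_sum, Finset.sum_add_distrib, hanti, zero_add]
  rw [hsum]
  have hB := Finset.sum_le_sum hlow
  have h2 : ∑ k ∈ univ.filter (fun k => 0 < (z k).im), 1 / (z k).im
      = 2 * ∑ k ∈ univ.filter (fun k => 0 < (z k).im), 1 / (2 * (z k).im) := by
    rw [Finset.mul_sum]
    refine Finset.sum_congr rfl fun k hk => ?_
    have hyk : (z k).im ≠ 0 := (Finset.mem_filter.mp hk).2.ne'
    field_simp
  rw [h2]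
  linarith

end Summit.RiemannHypothesis.RiemannHypothesis.Theorems.DbnTheory

end
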